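import Summits.Ventures.HodgeRepro2.T5SU11JacobiPhaseLawEven
import Summits.Ventures.HodgeRepro2.T5SU11OrbitRadiusLaw

/-!
# The law of the orbit radius at the even integer parameters in closed form:
`P_{k,4}(|g·0|² > y) = (2(k − 2)(1 − y)^{(k−4)/2} − (k − 4)(1 − y)^{(k−2)/2})/k`, and at `λ = 2n + 2` a signed mixture of
the power laws `(1 − y)^{(k−2−2i)/2}`

`{|g·0|² > y} = {log|a(g)| > −½ log(1 − y)}` (`T5SU11OrbitRadiusLaw.setOf_norm_orbit_sq_gt_eq`) turns the phase tails at
the even integer parameters (`T5SU11JacobiPhaseLawInteger`, `T5SU11JacobiPhaseLawEven`) into the law of the squared orbit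
radius, with `e^{−(k−2−2i)·(−½ log(1 − y))} = (1 − y)^{(k−2−2i)/2}`:

  **`P_{k,4}(|g·0|² > y) = (2(k − 2)(1 − y)^{(k−4)/2} − (k − 4)(1 − y)^{(k−2)/2})/k`**   (`orbit_sq_tail_prob_four_eq`, `k > 4`),

  **`P_{k,2n+2}(|g·0|² > y) = (Σ_{i ≤ n} c_{n,i} (1 − y)^{(k−2−2i)/2}/(k − 2 − 2i)) / (Σ_{i ≤ n} c_{n,i}/(k − 2 − 2i))`**
  (`orbit_sq_tail_prob_even_eq`, `k > 2n + 2`; `c_{n,i}` the coefficients of the shifted Legendre polynomial),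

for `0 ≤ y < 1` — at `λ = 0` the single power `(1 − y)^{(k−2)/2}` of `T5SU11OrbitRadiusLaw.orbit_sq_tail_prob` (a Beta law),
at `λ = 2n + 2` a signed mixture of `n + 1` such powers. Nothing is claimed about (N).

Blind lane: Mathlib + the HodgeRepro2 prefix only; no sorry; axioms ⊆ {propext, Classical.choice,
Quot.sound}.
-/

namespace Summit.Ventures.HodgeRepro2.T5SU11JacobiOrbitLawInteger

open MeasureTheory MeasureTheory.Measure Metric Set Filter Topology Finset
open T5SU11Unimodular T5SU11Fibration T5SU11Cartan T5SU11OneParameter T5SU11CartanProjection T5HaarCircle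
  T5BergmanCoefficient T5SU11FibrationHaar T5SU11SphericalFunction T5SU11SphericalSymmetry
  T5SU11SphericalBounds T5SU11SphericalContinuous T5SU11JacobiLaplacePhase T5SU11JacobiPhaseTailGroup
  T5SU11JacobiPhaseLawInteger T5SU11JacobiPhaseLawEven T5SU11OrbitRadiusLaw T5SU11JacobiWeight
  T5SU11KFiniteMajorantPow
open scoped Real

/-- `e^{−r·(−½ log(1 − y))} = (1 − y)^{r/2}` for `y < 1`. -/
theorem exp_neg_mul_neg_half_log_eq {r y : ℝ} (hy : y < 1) :
    Real.exp (-(r * (-(1 / 2) * Real.log (1 - y)))) = (1 - y) ^ (r / 2) := by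
  have h1 : 0 < 1 - y := by linarith
  rw [Real.rpow_def_of_pos h1]
  ring_nf

section measure

variable [MeasurableSpace Circle] [BorelSpace Circle]

/-- **The law of the squared orbit radius at `λ = 4`**: for `k > 4`, `0 ≤ y < 1`,
`P_{k,4}(|g·0|² > y) = (2(k − 2)(1 − y)^{(k−4)/2} − (k − 4)(1 − y)^{(k−2)/2})/k`. -/
theorem orbit_sq_tail_prob_four_eq {k : ℝ} (hk : 4 < k) {y : ℝ} (hy0 : 0 ≤ y) (hy1 : y < 1) :
    (∫ g in {g : SU11 | y < ‖orbit g‖ ^ 2}, (1 - ‖orbit g‖ ^ 2) ^ (k / 2) * sph 4 g ∂(nu haarCircle))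
        / (∫ g, (1 - ‖orbit g‖ ^ 2) ^ (k / 2) * sph 4 g ∂(nu haarCircle))
      = (2 * (k - 2) * (1 - y) ^ ((k - 4) / 2) - (k - 4) * (1 - y) ^ ((k - 2) / 2)) / k := by
  have h1 : 0 < 1 - y := by linarith
  have hx : 0 ≤ -(1 / 2) * Real.log (1 - y) := by
    have := Real.log_nonpos h1.le (by linarith)
    linarith
  rw [setOf_norm_orbit_sq_gt_eq hy1, phase_tail_prob_four_eq hk hx, exp_neg_mul_neg_half_log_eq hy1,
    exp_neg_mul_neg_half_log_eq hy1]

/-- **The law of the squared orbit radius at `λ = 2n + 2`**: for `k > 2n + 2`, `0 ≤ y < 1`,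
`P_{k,2n+2}(|g·0|² > y) = (Σ_i c_{n,i} (1 − y)^{(k−2−2i)/2}/(k − 2 − 2i)) / (Σ_i c_{n,i}/(k − 2 − 2i))`. -/
theorem orbit_sq_tail_prob_even_eq (n : ℕ) {k : ℝ} (hk : 2 * (n : ℝ) + 2 < k) {y : ℝ} (hy0 : 0 ≤ y) (hy1 : y < 1) :
    (∫ g in {g : SU11 | y < ‖orbit g‖ ^ 2}, (1 - ‖orbit g‖ ^ 2) ^ (k / 2) * sph (2 * (n : ℝ) + 2) g ∂(nu haarCircle))
        / (∫ g, (1 - ‖orbit g‖ ^ 2) ^ (k / 2) * sph (2 * (n : ℝ) + 2) g ∂(nu haarCircle))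
      = (∑ i ∈ range (n + 1), (legShift n).coeff i * ((1 - y) ^ ((k - 2 - 2 * (i : ℝ)) / 2) / (k - 2 - 2 * (i : ℝ))))
        / ∑ i ∈ range (n + 1), (legShift n).coeff i / (k - 2 - 2 * (i : ℝ)) := by
  have h1 : 0 < 1 - y := by linarith
  have hx : 0 ≤ -(1 / 2) * Real.log (1 - y) := by
    have := Real.log_nonpos h1.le (by linarith)
    linarith
  rw [setOf_norm_orbit_sq_gt_eq hy1, phase_tail_prob_even_eq n hk hx]
  congr 1
  refine Finset.sum_congr rfl fun i _ => ?_
  rw [exp_neg_mul_neg_half_log_eq hy1]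

end measure

end Summit.Ventures.HodgeRepro2.T5SU11JacobiOrbitLawInteger
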